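import Summits.HodgeConjecture.HodgeConjecture.Theorems.F0P3GlobalPacket          -- ★ (N) FILE 2 p840909: `GlobalPacket 𝔩`, `Mem` (+ ★ FILE 1 p840881∕ED. 2 p841458: `LocalPacketKit`, `ContainsAPacket`, `UniqLaw`)
import HarnessLib

/-!
# (N) DEFS, FILE 3b — THE GLOBAL PACKET OF A FAMILY OF LOCAL A-PACKETS `GlobalPacket.ofAPackets` (the finite-place part of the tuple's `PiXi ξ`) and the law (ℓ9) `UnrDefLaw`

Cell `hodgecm-mathlib`, F0∕P3 «U3-mult», crux H413 (`stmt-HodgeConjecture-24833`); FILE 3 census `CENSUS-N-FILE3-SpectralTuple…md` c70774ab T1 row #11 ∕ T3 (F0P3a-p01 (g11),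
(N) lead pen, 2026-09-01).  DEF LANE: two `Prop`∕data definitions with explicit binders + read-backs; no instance, no notation, no named fact, no `sorry`.  ASSERTS NOTHING.

WHAT.  Given a family of local A-packets `Pk v : CMLocalAPacket L H′ v` (the consumer's `Pk v := xiPacketFamilyOfRecordSCD … ξ v`, ★ p840594) such that every `Pk v` IS a
packet of the kit (`(𝔩 v).ContainsAPacket (Pk v)`, FILE 1 (ℓ6)) and the packets so obtained are unramified for almost all `v`, THE finite-place global packet
`Π(ξ)_fin := ⊗_v P_v` [Rogawski1990 §13.3 p. 201 ¶2; p. 200 `Π_a(G) = {Π(ξ)}`] — `loc v := Classical.choose`, CANONICAL under FILE 1 ED. 2's (ℓ7) `UniqLaw` when `(Pk v).πn`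
is not supercuspidal (`ContainsAPacket.unique`).  The law **(ℓ9) `UnrDefLaw`**: «`unr P` ↔ `P` contains a `K_v`-spherical member» — print's DEFINITION of «`Π_v`
contains an unramified representation» (p. 201 ¶2), which FILE 1's (ℓ4) `UnramLaw` only used in the forward direction; with (ℓ9) the cofinite hypothesis of
`ofAPackets` is discharged from the record's law `XiUnram` (★ `xiUnram_xiPacketFamilyOfRecordSCD`: `πⁿ(ξ_v)` is `K_v`-spherical off `ram ξ`).
HC_CM is proved only modulo the printed citations until rung 0 closes.
-/

set_option autoImplicit false
set_option linter.dupNamespace false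

noncomputable section

open NumberField IsDedekindDomain MeasureTheory Filter
open scoped Matrix MatrixGroups

namespace Summit.HodgeConjecture.HodgeConjecture.Cruxes.H413.F0P3GlobalPacket

open Literature.NumberTheory Literature.NumberTheory.Automorphic Literature.NumberTheory.Automorphic.UnitaryGroup
open Literature.NumberTheory.Rogawski1990 Literature.NumberTheory.GaloisRepresentations
open Summit.HodgeConjecture.HodgeConjecture.Cruxes.H413.F0P3LocalPacketKit

variable {L : Type} [Field L] [NumberField L] [IsCMField L] {H' : Matrix (Fin 3) (Fin 3) L}

/-! ## §1 (ℓ9) `UnrDefLaw` — print's definition of «`Π_v` contains an unramified representation» [p. 201 ¶2] -/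

/-- **(ℓ9) `UnrDefLaw`**: the kit's flag `unr P` holds iff `P` has a `K_v`-spherical member (`K_v = cmLocalIntegralLevel L 3 H′ v`) — print's definition (p. 201 ¶2
«`Π_v` contains an unramified representation `π_v⁰`»); FILE 1's (ℓ4) `UnramLaw` is the forward content (the member is unique, `⟨1, π_v⁰⟩ = 1`).
[cite: Rogawski1990, §13.3 p. 201 ¶2; §4.5 p. 45] -/
def UnrDefLaw {v : HeightOneSpectrum (𝓞 ↥(maximalRealSubfield L))} (𝔩 : LocalPacketKit L H' v) : Prop :=
  ∀ P : 𝔩.Pkt, 𝔩.unr P ↔ ∃ π ∈ 𝔩.mem P, π.IsSpherical (cmLocalIntegralLevel L 3 H' v)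

/-- Unfolding of `UnrDefLaw`. [cite: Rogawski1990, §13.3 p. 201 ¶2] -/
theorem unrDefLaw_iff {v : HeightOneSpectrum (𝓞 ↥(maximalRealSubfield L))} (𝔩 : LocalPacketKit L H' v) :
    UnrDefLaw 𝔩 ↔ ∀ P : 𝔩.Pkt, 𝔩.unr P ↔ ∃ π ∈ 𝔩.mem P, π.IsSpherical (cmLocalIntegralLevel L 3 H' v) :=
  Iff.rfl

/-! ## §2 The global packet of a family of local A-packets [p. 201 ¶2; p. 202 `Π_a(G)`] -/

variable {𝔩 : ∀ v : HeightOneSpectrum (𝓞 ↥(maximalRealSubfield L)), LocalPacketKit L H' v}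

/-- **The chosen local packet of the A-packet `Pk v`** (`Classical.choose` of FILE 1's (ℓ6) `ContainsAPacket`; canonical under (ℓ7), `chosenPkt_unique`).
[cite: Rogawski1990, §13.1 p. 198; §13.3 p. 202] -/
def chosenPkt (Pk : ∀ v : HeightOneSpectrum (𝓞 ↥(maximalRealSubfield L)), CMLocalAPacket L H' v)
    (h : ∀ v, (𝔩 v).ContainsAPacket (Pk v)) (v : HeightOneSpectrum (𝓞 ↥(maximalRealSubfield L))) : (𝔩 v).Pkt :=
  Classical.choose (h v)

/-- The chosen packet's members are exactly `{Pk.πn} ∪ Pk.πs` and `⟨1, πⁿ⟩ = 1` on it. [cite: Rogawski1990, §13.1 Prop. 13.1.3 (d) p. 199] -/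
theorem chosenPkt_spec (Pk : ∀ v : HeightOneSpectrum (𝓞 ↥(maximalRealSubfield L)), CMLocalAPacket L H' v)
    (h : ∀ v, (𝔩 v).ContainsAPacket (Pk v)) (v : HeightOneSpectrum (𝓞 ↥(maximalRealSubfield L))) :
    (∀ c : IrrClass ((UnitaryGroup.cmDatum L 3 H').Local v), c ∈ (𝔩 v).mem (chosenPkt Pk h v) ↔ (c = (Pk v).πn ∨ (Pk v).πs = some c)) ∧
      (𝔩 v).one (chosenPkt Pk h v) (Pk v).πn = 1 :=
  Classical.choose_spec (h v)

/-- `πⁿ` is a member of the chosen packet. [cite: Rogawski1990, §13.1 p. 198] -/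
theorem πn_mem_chosenPkt (Pk : ∀ v : HeightOneSpectrum (𝓞 ↥(maximalRealSubfield L)), CMLocalAPacket L H' v)
    (h : ∀ v, (𝔩 v).ContainsAPacket (Pk v)) (v : HeightOneSpectrum (𝓞 ↥(maximalRealSubfield L))) :
    (Pk v).πn ∈ (𝔩 v).mem (chosenPkt Pk h v) :=
  ((chosenPkt_spec Pk h v).1 (Pk v).πn).2 (Or.inl rfl)

/-- **CANONICITY**: under (ℓ7) `UniqLaw` at `v` and `πⁿ` non-supercuspidal, ANY packet witnessing `ContainsAPacket` is the chosen one.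
[cite: Rogawski1990, §13.1 p. 198] -/
theorem chosenPkt_unique (Pk : ∀ v : HeightOneSpectrum (𝓞 ↥(maximalRealSubfield L)), CMLocalAPacket L H' v)
    (h : ∀ v, (𝔩 v).ContainsAPacket (Pk v)) (v : HeightOneSpectrum (𝓞 ↥(maximalRealSubfield L)))
    (h𝔩 : (𝔩 v).UniqLaw) (hn : ¬ (Pk v).πn.IsSupercuspidal) (P : (𝔩 v).Pkt)
    (hP : (∀ c : IrrClass ((UnitaryGroup.cmDatum L 3 H').Local v), c ∈ (𝔩 v).mem P ↔ (c = (Pk v).πn ∨ (Pk v).πs = some c)) ∧ (𝔩 v).one P (Pk v).πn = 1) :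
    P = chosenPkt Pk h v :=
  LocalPacketKit.ContainsAPacket.unique (𝔩 v) h𝔩 (Pk v) hn P (chosenPkt Pk h v) hP (chosenPkt_spec Pk h v)

/-- **`GlobalPacket.ofAPackets` — THE FINITE-PLACE GLOBAL PACKET OF A FAMILY OF LOCAL A-PACKETS** (`Π(ξ)_fin` for `Pk := ` the SCD record of `ξ`): `loc v :=` the chosen
packet, `cofinite_unr :=` the hypothesis `hunr` (discharged by the consumer from (ℓ9) `UnrDefLaw` + the record's `XiUnram`, see `eventually_unr_chosenPkt_of_spherical`).
[cite: Rogawski1990, §13.3 p. 201 ¶2, p. 200] -/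
def ofAPackets (Pk : ∀ v : HeightOneSpectrum (𝓞 ↥(maximalRealSubfield L)), CMLocalAPacket L H' v)
    (h : ∀ v, (𝔩 v).ContainsAPacket (Pk v)) (hunr : ∀ᶠ v in cofinite, (𝔩 v).unr (chosenPkt Pk h v)) : GlobalPacket 𝔩 :=
  ⟨chosenPkt Pk h, hunr⟩

/-- `(ofAPackets …).loc v` is the chosen packet. [cite: Rogawski1990, §13.3 p. 201 ¶2] -/
theorem ofAPackets_loc (Pk : ∀ v : HeightOneSpectrum (𝓞 ↥(maximalRealSubfield L)), CMLocalAPacket L H' v)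
    (h : ∀ v, (𝔩 v).ContainsAPacket (Pk v)) (hunr : ∀ᶠ v in cofinite, (𝔩 v).unr (chosenPkt Pk h v))
    (v : HeightOneSpectrum (𝓞 ↥(maximalRealSubfield L))) :
    (ofAPackets Pk h hunr).loc v = chosenPkt Pk h v :=
  rfl

/-- Membership in `Π(ξ)_fin` at `v` is membership in `{πⁿ, πˢ}`. [cite: Rogawski1990, §13.1 Prop. 13.1.3 (d) p. 199] -/
theorem mem_ofAPackets_loc_iff (Pk : ∀ v : HeightOneSpectrum (𝓞 ↥(maximalRealSubfield L)), CMLocalAPacket L H' v)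
    (h : ∀ v, (𝔩 v).ContainsAPacket (Pk v)) (hunr : ∀ᶠ v in cofinite, (𝔩 v).unr (chosenPkt Pk h v))
    (v : HeightOneSpectrum (𝓞 ↥(maximalRealSubfield L))) (c : IrrClass ((UnitaryGroup.cmDatum L 3 H').Local v)) :
    c ∈ (𝔩 v).mem ((ofAPackets Pk h hunr).loc v) ↔ (c = (Pk v).πn ∨ (Pk v).πs = some c) :=
  (chosenPkt_spec Pk h v).1 c

/-- **Discharging `hunr` from (ℓ9) and the sphericity of `πⁿ` off a finite set** (the consumer feeds ★ `xiUnram_xiPacketFamilyOfRecordSCD`'s sphericity off `ram ξ`):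
if `UnrDefLaw` holds at every place and `(Pk v).πn` is `K_v`-spherical for almost all `v`, then the chosen packets are unramified for almost all `v`.
[cite: Rogawski1990, §13.3 p. 201 ¶2; §12.2 p. 174] -/
theorem eventually_unr_chosenPkt_of_spherical (Pk : ∀ v : HeightOneSpectrum (𝓞 ↥(maximalRealSubfield L)), CMLocalAPacket L H' v)
    (h : ∀ v, (𝔩 v).ContainsAPacket (Pk v)) (h9 : ∀ v, UnrDefLaw (𝔩 v))
    (hsph : ∀ᶠ v in cofinite, ((Pk v).πn).IsSpherical (cmLocalIntegralLevel L 3 H' v)) :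
    ∀ᶠ v in cofinite, (𝔩 v).unr (chosenPkt Pk h v) :=
  hsph.mono fun v hv => ((h9 v) (chosenPkt Pk h v)).2 ⟨(Pk v).πn, πn_mem_chosenPkt Pk h v, hv⟩

/-- **The πⁿ-family is a MEMBER of `Π(ξ)_fin`** when, at almost every place, it IS the kit's spherical member (`π v = sph …`, supplied by the consumer from (ℓ4)'s
uniqueness + `XiUnram`). [cite: Rogawski1990, §13.3 p. 201 ¶2, Thm. 13.3.6 (b) p. 202] -/
theorem πnFamily_mem_ofAPackets (Pk : ∀ v : HeightOneSpectrum (𝓞 ↥(maximalRealSubfield L)), CMLocalAPacket L H' v)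
    (h : ∀ v, (𝔩 v).ContainsAPacket (Pk v)) (hunr : ∀ᶠ v in cofinite, (𝔩 v).unr (chosenPkt Pk h v))
    (hsph : ∀ᶠ v in cofinite, ∃ hu : (𝔩 v).unr (chosenPkt Pk h v), (Pk v).πn = (𝔩 v).sph (chosenPkt Pk h v) hu) :
    (ofAPackets Pk h hunr).Mem fun v => (Pk v).πn :=
  ⟨fun v => πn_mem_chosenPkt Pk h v, hsph⟩

end Summit.HodgeConjecture.HodgeConjecture.Cruxes.H413.F0P3GlobalPacket
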